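import Summits.Ventures.GridStability.Models.StructurePreservingEnergy

/-!
# GridStability/Models/StructurePreservingDefinite — the Bergen–Hill potential energy vanishes
# only on the rotation orbit of the equilibrium (connected coupling graph)

LADDER-GRIDFUSION rung G3, seat gridfusion-model-2; companion of `StructurePreservingEnergy.lean`
(MODEL-VALIDITY row MV-3). There the printed potential energy
`W(δ, δ₀) = Σ_branches b_k ∫_{σ_k0}^{σ_k}(sin β − sin σ_k0)dβ` [cite: Padiyar2013, §3.2 eqs (3.12)–(3.13)];
[cite: BergenHill1981] was shown to satisfy `g(θ)·Q ≤ W ≤ Q` on the window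
{|σ_k| ≤ π/2, |σ_k0| ≤ θ < π/2}, `Q = ½ Σᵢ Σⱼ bᵢⱼ (Δσᵢⱼ)²/2`, with the strict sector gain
`g(θ) > 0` of [cite: VuTuritsyn2017, §IV-A] — and positive DEFINITENESS was explicitly left open,
because `W` (like the model) is invariant under a common shift of all bus angles. This file settles
what definiteness means here: on the window, `W(δ, δ₀) = 0` iff `δ` differs from `δ₀` by a COMMON
rotation on every connected component of the coupling graph (`bᵢⱼ ≠ 0`); for a (pre)connected
network, iff `δ = δ₀ + c·1`. This is the «modulo the rotational symmetry» proviso of the energy-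
function literature made precise (e.g. the reference-angle / COI reduction of
[cite: Padiyar2013, §3.2 eq (3.6)]: «it is possible to define (n − 1) internodal angles»), and the
hypothesis under which a sublevel-set / LaSalle argument for MODEL MV-3 can isolate the equilibrium.

## Contents
* `Params.couplingGraph` — the simple graph on the buses with `i ~ j` iff `i ≠ j` and
  `bᵢⱼ ≠ 0 ≠ bⱼᵢ`;
* `quadraticGap_nonneg`, `quadraticGap_eq_zero_iff` — `Q ≥ 0`, and `Q = 0` iff every COUPLED
  branch deviation vanishes (`bᵢⱼ ≥ 0`);
* `potential_eq_zero_iff_branches` — on the window, `W = 0` iff every coupled branch deviation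
  vanishes (lower bound `potential_ge_quadratic` + upper bound `potential_le_quadratic`);
* `eq_of_reachable` — branch deviations vanishing on edges propagate along walks;
* `potential_eq_zero_iff_shift` — for a preconnected coupling graph (and `n ≠ 0`), `W(δ, δ₀) = 0`
  on the window iff `∃ c, ∀ i, δ i = δ₀ i + c`;
* `energy_eq_zero_iff` — the same for `V = kinetic + W` with, in addition, zero frequency at
  every generator node (`Mᵢ > 0` there; load buses carry no kinetic term, as printed).

MODELLED (three columns): statements about the typed model MV-3 only; no certificate; nothing
about any grid. Connectivity of the post-fault network is a HYPOTHESIS to be discharged per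
instance (model-4's data), not assumed silently.
-/

noncomputable section

open Finset Real

namespace Summit.Ventures.GridStability.Models.StructurePreserving.Params

variable {n : ℕ}

/-- The coupling graph of structure-preserving data: buses `i ≠ j` are adjacent iff they are
joined by a branch with nonzero coefficient in both directions (`bᵢⱼ ≠ 0` and `bⱼᵢ ≠ 0`; for the
printed symmetric `b` the two conditions coincide). -/
def couplingGraph (p : Params n) : SimpleGraph (Fin n) where
  Adj i j := i ≠ j ∧ p.b i j ≠ 0 ∧ p.b j i ≠ 0
  symm := ⟨fun _ _ h => ⟨h.1.symm, h.2.2, h.2.1⟩⟩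
  loopless := ⟨fun _ h => h.1 rfl⟩

/-- Adjacency unfolds to the defining condition. -/
theorem couplingGraph_adj (p : Params n) (i j : Fin n) :
    p.couplingGraph.Adj i j ↔ i ≠ j ∧ p.b i j ≠ 0 ∧ p.b j i ≠ 0 := Iff.rfl

/-- For symmetric couplings adjacency needs only `bᵢⱼ ≠ 0`. -/
theorem couplingGraph_adj_of_symm (p : Params n) (hb : ∀ i j, p.b i j = p.b j i) (i j : Fin n) :
    p.couplingGraph.Adj i j ↔ i ≠ j ∧ p.b i j ≠ 0 := by
  rw [couplingGraph_adj, hb j i]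
  tauto

/-- The quadratic comparison form `Q(δ, δ₀) = ½ Σᵢ Σⱼ bᵢⱼ ((δᵢ − δⱼ) − (δ₀ᵢ − δ₀ⱼ))²/2` of
`StructurePreservingEnergy` (written out; no new definition is introduced for it). It is
nonnegative for `bᵢⱼ ≥ 0`. -/
theorem quadraticGap_nonneg (p : Params n) (hb : ∀ i j, 0 ≤ p.b i j) (δ₀ δ : Fin n → ℝ) :
    0 ≤ (1 / 2) * ∑ i, ∑ j, p.b i j * (((δ i - δ j) - (δ₀ i - δ₀ j)) ^ 2 / 2) :=
  mul_nonneg (by norm_num) (Finset.sum_nonneg fun i _ => Finset.sum_nonneg fun j _ =>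
    mul_nonneg (hb i j) (by positivity))

/-- `Q = 0` iff every COUPLED branch deviation vanishes (`bᵢⱼ ≥ 0`): a finite sum of nonnegative
terms vanishes termwise. -/
theorem quadraticGap_eq_zero_iff (p : Params n) (hb : ∀ i j, 0 ≤ p.b i j) (δ₀ δ : Fin n → ℝ) :
    (1 / 2) * ∑ i, ∑ j, p.b i j * (((δ i - δ j) - (δ₀ i - δ₀ j)) ^ 2 / 2) = 0
      ↔ ∀ i j, p.b i j ≠ 0 → δ i - δ j = δ₀ i - δ₀ j := by
  have hterm : ∀ i j, 0 ≤ p.b i j * (((δ i - δ j) - (δ₀ i - δ₀ j)) ^ 2 / 2) :=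
    fun i j => mul_nonneg (hb i j) (by positivity)
  constructor
  · intro h i j hij
    have h1 : ∑ i, ∑ j, p.b i j * (((δ i - δ j) - (δ₀ i - δ₀ j)) ^ 2 / 2) = 0 := by
      have : (1 / 2 : ℝ) ≠ 0 := by norm_num
      exact (mul_eq_zero.mp h).resolve_left this
    have h2 := (Finset.sum_eq_zero_iff_of_nonneg fun i _ =>
      Finset.sum_nonneg fun j _ => hterm i j).mp h1 i (mem_univ i)
    have h3 := (Finset.sum_eq_zero_iff_of_nonneg fun j _ => hterm i j).mp h2 j (mem_univ j)
    have h4 : ((δ i - δ j) - (δ₀ i - δ₀ j)) ^ 2 / 2 = 0 := (mul_eq_zero.mp h3).resolve_left hij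
    have h5 : (δ i - δ j) - (δ₀ i - δ₀ j) = 0 := by
      have : ((δ i - δ j) - (δ₀ i - δ₀ j)) ^ 2 = 0 := by linarith
      exact pow_eq_zero_iff (n := 2) (by norm_num) |>.mp this
    linarith
  · intro h
    have : ∑ i, ∑ j, p.b i j * (((δ i - δ j) - (δ₀ i - δ₀ j)) ^ 2 / 2) = 0 := by
      refine Finset.sum_eq_zero fun i _ => Finset.sum_eq_zero fun j _ => ?_
      by_cases hij : p.b i j = 0
      · simp [hij]
      · rw [h i j hij]; ring
    rw [this, mul_zero]

/-- **On the window, `W = 0` iff every coupled branch deviation vanishes** (`bᵢⱼ ≥ 0`, reference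
branch angles `|δ₀ᵢ − δ₀ⱼ| ≤ θ < π/2` and current branch angles `|δᵢ − δⱼ| ≤ π/2` on coupled
pairs): from `g(θ)·Q ≤ W ≤ Q` and `g(θ) > 0`. -/
theorem potential_eq_zero_iff_branches (p : Params n) (hb : ∀ i j, 0 ≤ p.b i j)
    {δ₀ δ : Fin n → ℝ} {θ : ℝ} (hθ0 : 0 ≤ θ) (hθ : θ < π / 2)
    (h0 : ∀ i j, p.b i j ≠ 0 → |δ₀ i - δ₀ j| ≤ θ)
    (hP : ∀ i j, p.b i j ≠ 0 → |δ i - δ j| ≤ π / 2) :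
    p.potential δ₀ δ = 0 ↔ ∀ i j, p.b i j ≠ 0 → δ i - δ j = δ₀ i - δ₀ j := by
  have hg : 0 < (1 - Real.sin θ) / (π / 2 - θ) :=
    Literature.MathematicalPhysics.PowerSystems.SinusoidalCoupling.sectorGain_pos hθ0 hθ
  have hlow := p.potential_ge_quadratic hb hθ0 hθ h0 hP
  have hup := p.potential_le_quadratic δ₀ δ hb
  have hQ := p.quadraticGap_nonneg hb δ₀ δ
  rw [← p.quadraticGap_eq_zero_iff hb δ₀ δ]
  constructor
  · intro hW
    rw [hW] at hlow
    -- g·Q ≤ 0 with g > 0 and Q ≥ 0 forces Q = 0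
    have : (1 - Real.sin θ) / (π / 2 - θ)
        * ((1 / 2) * ∑ i, ∑ j, p.b i j * (((δ i - δ j) - (δ₀ i - δ₀ j)) ^ 2 / 2)) ≤ 0 := hlow
    nlinarith
  · intro hQ0
    rw [hQ0] at hup
    rw [hQ0, mul_zero] at hlow
    exact le_antisymm hup hlow

/-- Branch deviations that vanish on every edge of the coupling graph vanish between any two
REACHABLE buses (telescoping along a walk). -/
theorem eq_of_reachable (p : Params n) {φ : Fin n → ℝ}
    (h : ∀ i j, p.couplingGraph.Adj i j → φ i = φ j) {i j : Fin n}
    (hr : p.couplingGraph.Reachable i j) : φ i = φ j := by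
  obtain ⟨w⟩ := hr
  induction w with
  | nil => rfl
  | cons hadj _ ih => exact (h _ _ hadj).trans ih

/-- A common rotation of all bus angles costs no potential energy: `W(δ₀ + c·1, δ₀) = 0`
(the symmetry that makes one reference angle redundant [cite: Padiyar2013, §3.2 eq (3.6)]). -/
theorem potential_shift_eq_zero (p : Params n) (δ₀ : Fin n → ℝ) (c : ℝ) :
    p.potential δ₀ (fun i => δ₀ i + c) = 0 := by
  unfold potential
  simp

/-- **`W` vanishes exactly on the rotation orbit of the equilibrium** (preconnected coupling graph,
`n ≠ 0`, symmetric susceptive couplings `bᵢⱼ = bⱼᵢ ≥ 0`, and the window: `|δ₀ᵢ − δ₀ⱼ| ≤ θ < π/2`,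
`|δᵢ − δⱼ| ≤ π/2` on coupled pairs): `W(δ, δ₀) = 0 ↔ ∃ c, ∀ i, δᵢ = δ₀ᵢ + c`. For MODEL MV-3
this is positive definiteness of the printed potential energy in the (n − 1) internodal angles on
the window — the hypothesis a Lyapunov / LaSalle argument needs to isolate the equilibrium. -/
theorem potential_eq_zero_iff_shift (p : Params n) (hn : n ≠ 0)
    (hconn : p.couplingGraph.Preconnected) (hbs : ∀ i j, p.b i j = p.b j i)
    (hb : ∀ i j, 0 ≤ p.b i j) {δ₀ δ : Fin n → ℝ} {θ : ℝ} (hθ0 : 0 ≤ θ) (hθ : θ < π / 2)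
    (h0 : ∀ i j, p.b i j ≠ 0 → |δ₀ i - δ₀ j| ≤ θ)
    (hP : ∀ i j, p.b i j ≠ 0 → |δ i - δ j| ≤ π / 2) :
    p.potential δ₀ δ = 0 ↔ ∃ c, ∀ i, δ i = δ₀ i + c := by
  rw [p.potential_eq_zero_iff_branches hb hθ0 hθ h0 hP]
  constructor
  · intro h
    -- the deviation φᵢ = δᵢ − δ₀ᵢ is constant on edges, hence (preconnected) everywhere
    have hedge : ∀ i j, p.couplingGraph.Adj i j → δ i - δ₀ i = δ j - δ₀ j := by
      intro i j hij
      have := h i j ((p.couplingGraph_adj_of_symm hbs i j).mp hij).2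
      linarith
    obtain ⟨k, hk⟩ := Nat.exists_eq_succ_of_ne_zero hn
    subst hk
    refine ⟨δ 0 - δ₀ 0, fun i => ?_⟩
    have key : δ i - δ₀ i = δ 0 - δ₀ 0 :=
      p.eq_of_reachable (φ := fun i => δ i - δ₀ i) hedge (hconn i 0)
    linarith
  · rintro ⟨c, hc⟩ i j _
    rw [hc i, hc j]
    ring

/-- Zero kinetic energy means zero frequency at every generator node (`Mᵢ > 0` there); load buses
carry no kinetic term [cite: Padiyar2013, §3.2 eq (3.14)]. -/
theorem kinetic_eq_zero_iff (p : Params n) (hM : ∀ i ∈ p.gen, 0 < p.M i) (ω : Fin n → ℝ) :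
    p.kinetic ω = 0 ↔ ∀ i ∈ p.gen, ω i = 0 := by
  unfold kinetic
  have hterm : ∀ i ∈ p.gen, 0 ≤ p.M i * ω i ^ 2 := fun i hi => mul_nonneg (hM i hi).le (sq_nonneg _)
  constructor
  · intro h i hi
    have h1 : ∑ i ∈ p.gen, p.M i * ω i ^ 2 = 0 :=
      (mul_eq_zero.mp h).resolve_left (by norm_num)
    have h2 := (Finset.sum_eq_zero_iff_of_nonneg hterm).mp h1 i hi
    have h3 : ω i ^ 2 = 0 := (mul_eq_zero.mp h2).resolve_left (hM i hi).ne'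
    exact pow_eq_zero_iff (n := 2) (by norm_num) |>.mp h3
  · intro h
    have : ∑ i ∈ p.gen, p.M i * ω i ^ 2 = 0 :=
      Finset.sum_eq_zero fun i hi => by rw [h i hi]; ring
    rw [this, mul_zero]

/-- **Zero set of the topological Lyapunov function on the window** (well-formed data with
susceptive couplings, preconnected coupling graph, `n ≠ 0`): `V(δ, ω) = 0` iff `δ` is a common
rotation of the equilibrium `δ₀` AND every generator frequency vanishes — i.e. `V` is positive
definite on the window in the reduced state (internodal angles, generator frequencies) of
[cite: Padiyar2013, §3.2 eqs (3.6), (3.11)]. MODEL MV-3 only. -/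
theorem energy_eq_zero_iff {p : Params n} (hp : p.WellFormed) (hn : n ≠ 0)
    (hconn : p.couplingGraph.Preconnected) (hb : ∀ i j, 0 ≤ p.b i j)
    {δ₀ δ : Fin n → ℝ} {θ : ℝ} (hθ0 : 0 ≤ θ) (hθ : θ < π / 2)
    (h0 : ∀ i j, p.b i j ≠ 0 → |δ₀ i - δ₀ j| ≤ θ)
    (hP : ∀ i j, p.b i j ≠ 0 → |δ i - δ j| ≤ π / 2) (ω : Fin n → ℝ) :
    p.energy δ₀ δ ω = 0 ↔ (∃ c, ∀ i, δ i = δ₀ i + c) ∧ ∀ i ∈ p.gen, ω i = 0 := by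
  have hK := p.kinetic_nonneg (fun i hi => (hp.M_pos i hi).le) ω
  have hPP : ∀ i j, p.b i j ≠ 0 → |(δ i - δ j) + (δ₀ i - δ₀ j)| ≤ π := by
    intro i j hij
    have h1 := abs_le.mp (hP i j hij)
    have h2 := abs_le.mp ((h0 i j hij).trans hθ.le)
    exact abs_le.mpr ⟨by linarith [h1.1, h2.1], by linarith [h1.2, h2.2]⟩
  have hW : 0 ≤ p.potential δ₀ δ :=
    p.potential_nonneg hb (fun i j hij => (h0 i j hij).trans hθ.le) hPP
  rw [← p.potential_eq_zero_iff_shift hn hconn hp.b_symm hb hθ0 hθ h0 hP,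
    ← p.kinetic_eq_zero_iff hp.M_pos ω, energy]
  constructor
  · intro h
    exact ⟨by linarith, by linarith⟩
  · rintro ⟨h1, h2⟩
    rw [h1, h2, add_zero]

end Summit.Ventures.GridStability.Models.StructurePreserving.Params

end
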